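import Mathlib
import Summits.Ventures.PercRepro2.SwOutCrossJunctionMark

/-!
# The mark anywhere at the region level: the class statement and the base region (blind cell
PercRepro2, night-4 g27, 2026-08-28; proofs/NIGHT4-G27.md §6′)

`sw_of_crossJunctionM` works on the region `{l}ᶜ`.  For the series reduction (`Reducible`) the
class statement is needed on an arbitrary region `U` with `l ∉ U`: **`CrossJunctionM.rigidOK`**
(the rigid inequality on every class of a cross junction whose mark is any vertex, for every
outside colouring — by the position of the mark, from `rigidOK_of_crossJunctionU`,
`rigidOK_of_crossJunctionQ_any`, `rigidOK_of_crossJunction_any`) and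
**`CrossJunctionM.reducible`** (such a region is a base region of the series reduction): a region
that reduces by series / leaf / loop steps to cross-junction regions with the mark anywhere is
reducible, hence satisfies rows (SW) / 2′SW-ALL.
-/

namespace Summit.Ventures.PercRepro2

namespace CrossArm

open Hull LocRows

universe u uV

variable {V : Type uV} {E : Type*} [Fintype E] [DecidableEq E]

open scoped Classical

variable {ends : E → Sym2 V} {X : Type u} [Fintype X] [DecidableEq X] [Nonempty X]
  {G : SimpleGraph X} [DecidableRel G.Adj] {U : Set V} {l h o u : V} {p : X → V}

/-- **THEOREM A_cross WITH THE MARK ANYWHERE: the rigid inequality on every class of a cross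
junction whose mark is any vertex**, for every outside colouring — by the position of the mark:
at the junction (`rigidOK_of_crossJunctionU`), at a dropped vertex
(`rigidOK_of_crossJunctionQ_any`), elsewhere (`rigidOK_of_crossJunction_any`). -/
theorem CrossJunctionM.rigidOK (hj : CrossJunctionM ends U h u p G o) (hl : l ∉ U)
    (ξ : Config E) : RigidOK ends l h o U ξ := by
  by_cases hou : o = u
  · subst hou
    exact (hj.toU rfl).rigidOK_of_crossJunctionU hl ξ
  by_cases hop : ∃ r, o = p r
  · obtain ⟨r, hr⟩ := hop
    exact (hj.toQ r hr).rigidOK_of_crossJunctionQ_any hl ξ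
  · exact (hj.toCrossJunction hou fun i hi => hop ⟨i, hi⟩).rigidOK_of_crossJunction_any hl ξ

/-- **A region with a cross junction whose mark is any vertex is a base region of the series
reduction.** -/
theorem CrossJunctionM.reducible (hj : CrossJunctionM ends U h u p G o) (hl : l ∉ U) :
    Reducible l h o ends U :=
  Reducible.base ends U fun ξ => hj.rigidOK hl ξ

/-- Row 2′SW-ALL on `{l}ᶜ` through the base region (the same statement as
`swAll_of_crossJunctionM`, by the reduction). -/
theorem swAll_of_crossJunctionM' (hlh : l ≠ h) (hj : CrossJunctionM ends ({l}ᶜ) h u p G o) :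
    SwAll ends l h o :=
  swAll_of_reducible l h o hlh (hj.reducible (by simp))

end CrossArm

end Summit.Ventures.PercRepro2
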